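import Summits.ResolutionOfSingularities.ResolutionOfSingularities.Theorems.FrobeniusClosingPatchingRelPerfectDepthPhaseCLocalGamePersistenceRows
import HarnessLib

/-!
# Crux `PatchingRelPerfect` (stmt-ResolutionOfSingularities-16161), chain W5.2 — F7(β) (β-AX) X3 C-I (G2) engine:
# (G-P) PERSISTENCE OF LOCAL END under the blow-up of a regular local-stratum centre (`EndStratumStep`, unfolded), part 2

[OURS · L1 W5.2 · res-L1-w52-idea-1 Sketch v19 §4.5 (G-P) `X3LemmaM.EndStratumStep` 8ba1c33b3f45dd7b l.413–428, RULINGS G12-27/G12-29/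
G12-32 → res-D-pv-046 ((G2) engine hand)] Replaces the role of NO printed item; NOT a statement of the manuscript under review; fact-free; any
dimension. `IsEndNear` / `IsEndPresentation` / `singGE` are res-L1-w52-idea-1's sketch definitions, not yet in the tree: this file proves
(G-P) with those predicates UNFOLDED (a three-line wrapper gives the literal Prop once the definitions land).

* **`endStratumStep`** — `X` regular locally Noetherian, `K` locally END at every point of `cosupp K` (on some open `U ∋ x`, for a sub-list
  `Λ ⊆ 𝓛` restricting to an snc family on `U` and exponent rows `𝒦 ≠ []` on `Λ`, `K|_U = (Σ_{A ∈ 𝒦} Λ^A)|_U`), `C` a regular centre inside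
  `Sing(K, m)` which near each of its points is the stratum `⋂_{F ∈ J} V(F)` of such a presentation: then `Bl_C X` is regular,
  `K·𝒪 = (C·𝒪)^m · K₁` with `(C·𝒪)^m` effective Cartier, `K₁ = (π^*K : (C·𝒪)^m)` is locally END at every point of its cosupport with letters
  `𝓛.map st ++ [C·𝒪]`, and `cosupp K₁` lies over `cosupp K`.  Per point of `cosupp K₁`: AT the centre, the stratum presentation shrunk to a
  patch where `V(C)` is irreducible (`exists_opens_isIrreducible_support_inter`) and part 1's `controlledTransform_eq_rows_onCentre`; OFF the
  centre, any presentation shrunk off `V(C)` and `controlledTransform_eq_rows_offCentre`; both transported by `isEndNear_transform_of_rows`.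

AI-written; AI review is weaker than expert review.

## References (for the mathematics; nothing here is a statement of the manuscript under review)
* J. Kollár, *Lectures on Resolution of Singularities* (2007), (3.111) Step 3, Def. 3.65. [Kollar2007]
* E. Bierstone, D. Grigoriev, P. Milman, J. Włodarczyk, arXiv:1206.3090, Def. 3.1.3, Lemma 3.2.1, §4 Step 2b. [BierstoneGrigorievMilmanWlodarczyk2011]
* U. Görtz, T. Wedhorn, *Algebraic Geometry I* (2nd ed. 2020), Prop. 13.91. [GortzWedhorn2020]
-/

-- `Summit.<Summit>.<Sub>.Theorems` with `Sub = Summit` (single-conjunct summit, D-0017)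
set_option linter.dupNamespace false

noncomputable section

open CategoryTheory AlgebraicGeometry TopologicalSpace IsLocalRing
open Literature.AlgebraicGeometry.Resolution
open Scheme.IdealSheafData (vanishingIdeal)

namespace Summit.ResolutionOfSingularities.ResolutionOfSingularities.Theorems

namespace X3LemmaM

open DepthTargets (monomialSum monomialSum_nil monomialSum_cons)
open DepthMultiHost (comap_monomialSum_map boundaryOf_map_comap)

universe u

variable {X : Scheme.{u}}

/-! ## §6 (G-P) `EndStratumStep`, unfolded -/

section Main

variable [IsLocallyNoetherian X]

omit [IsLocallyNoetherian X] in
/-- Restricting an equality of restricted ideal sheaves to a smaller open. [folklore] -/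
theorem comap_ι_eq_of_le {U U₀ : X.Opens} (hle : U ≤ U₀) {A B : X.IdealSheafData} (h : A.comap U₀.ι = B.comap U₀.ι) :
    A.comap U.ι = B.comap U.ι := by
  have hc : ∀ F : X.IdealSheafData, F.comap U.ι = (F.comap U₀.ι).comap (X.homOfLE hle) := fun F => by
    rw [← Scheme.IdealSheafData.comap_comp, X.homOfLE_ι hle]
  rw [hc, hc, h]

/-- Restricting an snc letter family to a smaller open. [folklore] -/
theorem hasSNC_map_comap_ι_of_le {U U₀ : X.Opens} (hle : U ≤ U₀) {Λ : List X.IdealSheafData}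
    (hsnc : HasSNC (Λ.map fun F => F.comap U₀.ι)) : HasSNC (Λ.map fun F => F.comap U.ι) := by
  have hc : ∀ F : X.IdealSheafData, F.comap U.ι = (F.comap U₀.ι).comap (X.homOfLE hle) := fun F => by
    rw [← Scheme.IdealSheafData.comap_comp, X.homOfLE_ι hle]
  have h1 : Λ.map (fun F => F.comap U.ι) = (Λ.map fun F => F.comap U₀.ι).map fun F => F.comap (X.homOfLE hle) := by
    rw [List.map_map]; exact List.map_congr_left fun F _ => hc F
  rw [h1]
  have h2 := hsnc.comap_of_isOpenImmersion (X.homOfLE hle)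
  rwa [Scheme.IdealSheafData.comap_top] at h2

omit [IsLocallyNoetherian X] in
/-- Pulling back a finite join of letters along an open. [folklore] -/
theorem comap_foldr_sup {Y : Scheme.{u}} (f : Y ⟶ X) :
    ∀ J : List X.IdealSheafData, (J.foldr (· ⊔ ·) ⊥).comap f = (J.map fun F => F.comap f).foldr (· ⊔ ·) ⊥
  | [] => by simp
  | F :: J => by
    rw [List.foldr_cons, List.map_cons, List.foldr_cons, Scheme.IdealSheafData.comap_sup, comap_foldr_sup f J]

/-- A finite join of members of an snc family is a stratum ideal (`Finset.sup`): the centre is snc with the family.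
[cite: Kollar2007, Def. 3.25] -/
theorem hasSNCWith_foldr_sup {Y : Scheme.{u}} [IsLocallyNoetherian Y] {Es J : List Y.IdealSheafData} (hEs : HasSNC Es)
    (hJ : ∀ F ∈ J, F ∈ Es) : HasSNCWith Es (J.foldr (· ⊔ ·) ⊥) := by
  classical
  rw [List.foldr_sup_eq_sup_toFinset]
  exact hEs.hasSNCWith_finsetSup J.toFinset fun F hF => hJ F (List.mem_toFinset.mp hF)

/-- [OURS · L1 W5.2] **(G-P) PERSISTENCE STEP (`X3LemmaM.EndStratumStep`, unfolded).** `X` regular locally Noetherian, `K` locally END at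
every point of `cosupp K` with letters from `𝓛`, `m ≥ 1`, `C` a regular centre inside `Sing(K, m)` which near each of its points is the
stratum `⋂_{F ∈ J} V(F)` of a local END presentation (`C|_U = (Σ_{F ∈ J} F)|_U`).  Then `Bl_C X` is regular, `K·𝒪 = (C·𝒪)^m · K₁` with
`(C·𝒪)^m` effective Cartier and `K₁ = (π^*K : (C·𝒪)^m)`, `K₁` is locally END at every point of its cosupport with letters the strict
transforms `𝓛.map st` and the exceptional ideal `C·𝒪`, and `cosupp K₁` lies over `cosupp K`. [cite: Kollar2007, (3.111) Step 3, Def. 3.65]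
[cite: BierstoneGrigorievMilmanWlodarczyk2011, Def. 3.1.3, Lemma 3.2.1, §4 Step 2b] [cite: GortzWedhorn2020, Prop. 13.91] -/
theorem endStratumStep (hX : Scheme.IsRegular X) (K C : X.IdealSheafData) (𝓛 : List X.IdealSheafData) (m : ℕ)
    (hEnd : ∀ x ∈ (K.support : Set X), ∃ Λ : List X.IdealSheafData, (∀ F ∈ Λ, F ∈ 𝓛) ∧
      ∃ U : X.Opens, x ∈ (U : Set X) ∧ HasSNC (Λ.map fun F => F.comap U.ι) ∧
        ∃ 𝒦 : List (List (X.IdealSheafData × ℕ)), (∀ L ∈ 𝒦, boundaryOf L = Λ) ∧ 𝒦 ≠ [] ∧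
          K.comap U.ι = (monomialSum 𝒦).comap U.ι)
    (hCreg : Scheme.IsRegular C.subscheme) (hCsing : (C.support : Set X) ⊆ (⟨K, [], m⟩ : MarkedIdeal X).support)
    (hCstr : ∀ y ∈ (C.support : Set X), ∃ (U : X.Opens) (Λ J : List X.IdealSheafData) (𝒦 : List (List (X.IdealSheafData × ℕ))),
      (y ∈ (U : Set X) ∧ (∀ F ∈ Λ, F ∈ 𝓛) ∧ HasSNC (Λ.map fun F => F.comap U.ι) ∧ (∀ L ∈ 𝒦, boundaryOf L = Λ) ∧ 𝒦 ≠ [] ∧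
        K.comap U.ι = (monomialSum 𝒦).comap U.ι) ∧ (∀ F ∈ J, F ∈ Λ) ∧ C.comap U.ι = (J.foldr (· ⊔ ·) ⊥).comap U.ι) :
    Scheme.IsRegular (blowup C) ∧
      K.comap (blowup.π C) = (C.comap (blowup.π C)) ^ m * controlledTransform (blowup.π C) C K m ∧
      IsEffectiveCartier ((C.comap (blowup.π C)) ^ m) ∧
      (∀ x' ∈ ((controlledTransform (blowup.π C) C K m).support : Set (blowup C)),
        ∃ Λ₁ : List (blowup C).IdealSheafData,
          (∀ F ∈ Λ₁, F ∈ 𝓛.map (strictTransformIdeal (blowup.π C) C) ++ [C.comap (blowup.π C)]) ∧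
          ∃ U₁ : (blowup C).Opens, x' ∈ (U₁ : Set (blowup C)) ∧ HasSNC (Λ₁.map fun F => F.comap U₁.ι) ∧
            ∃ 𝒦₁ : List (List ((blowup C).IdealSheafData × ℕ)), (∀ L ∈ 𝒦₁, boundaryOf L = Λ₁) ∧ 𝒦₁ ≠ [] ∧
              (controlledTransform (blowup.π C) C K m).comap U₁.ι = (monomialSum 𝒦₁).comap U₁.ι) ∧
      ((controlledTransform (blowup.π C) C K m).support : Set (blowup C)) ⊆ blowup.π C ⁻¹' (K.support : Set X) := by
  haveI : IsLocallyNoetherian (blowup C) := CentreSeq.isLocallyNoetherian_blowup C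
  have hπ : IsBlowup (blowup.π C) C := blowup.isBlowup C
  -- `K ⊆ C^m` (BGMW Lemma 3.2.1) and the factorisation
  have hle : K.comap (blowup.π C) ≤ C.comap (blowup.π C) ^ m := by
    have h := MarkedIdeal.comap_ideal_le_pow (M := (⟨K, [], m⟩ : MarkedIdeal X)) hCsing
      (hasSNCWith_nil_of_isRegular hX hCreg) (blowup.π C)
    exact h
  have hsupp : ((controlledTransform (blowup.π C) C K m).support : Set (blowup C)) ⊆ blowup.π C ⁻¹' (K.support : Set X) := by
    intro x' hx'
    have h := Scheme.IdealSheafData.support_antitone (comap_le_controlledTransform (blowup.π C) C K m) hx'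
    rw [Scheme.IdealSheafData.support_comap] at h
    exact h
  refine ⟨hπ.isRegular_of_isRegular_subscheme hX hCreg, (pow_mul_controlledTransform_eq (blowup.π C) C hπ.isEffectiveCartier hle).symm,
    hπ.isEffectiveCartier.pow m, fun x' hx' => ?_, hsupp⟩
  have hxK : blowup.π C x' ∈ (K.support : Set X) := hsupp hx'
  by_cases hxC : blowup.π C x' ∈ (C.support : Set X)
  · -- AT the centre: the stratum presentation, shrunk to a patch on which `V(C)` is irreducible
    obtain ⟨U₀, Λ, J, 𝒦, ⟨hxU₀, hΛ, hsnc₀, hbd, hne, hK₀⟩, hJ, hC₀⟩ := hCstr _ hxC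
    obtain ⟨V, hxV, hirr⟩ := exists_opens_isIrreducible_support_inter C hCreg hxC
    set U : X.Opens := U₀ ⊓ V with hU
    have hxU : blowup.π C x' ∈ (U : Set X) := ⟨hxU₀, hxV⟩
    have hsnc := hasSNC_map_comap_ι_of_le (inf_le_left : U ≤ U₀) hsnc₀
    have hKU := comap_ι_eq_of_le (inf_le_left : U ≤ U₀) hK₀
    have hCU := comap_ι_eq_of_le (inf_le_left : U ≤ U₀) hC₀
    -- the centre on the patch: regular, irreducible support, snc with the letters
    have hCregU : Scheme.IsRegular (C.comap U.ι).subscheme := isRegular_subscheme_comap_of_isOpenImmersion U.ι C hCreg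
    have hirrU : IsIrreducible (((C.comap U.ι).support : Set (U : Scheme.{u}))) := by
      have h1 : (((C.comap U.ι).support : Set (U : Scheme.{u}))) = U.ι.base ⁻¹' ((C.support : Set X) ∩ (V : Set X)) := by
        rw [Scheme.IdealSheafData.support_comap, Set.preimage_inter]
        ext u
        refine ⟨fun h => ⟨h, ?_⟩, fun h => h.1⟩
        rw [Set.mem_preimage, Scheme.Opens.ι_apply]
        exact u.2.2
      rw [h1]
      refine hirr.preimage U.ι.isOpenEmbedding ⟨blowup.π C x', ⟨hxC, hxV⟩, ⟨⟨blowup.π C x', hxU⟩, rfl⟩⟩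
    have hsncD : HasSNCWith (Λ.map fun F => F.comap U.ι) (C.comap U.ι) := by
      rw [hCU, comap_foldr_sup]
      exact hasSNCWith_foldr_sup hsnc fun F hF => by
        obtain ⟨F₀, hF₀, rfl⟩ := List.mem_map.mp hF
        exact List.mem_map.mpr ⟨F₀, hJ F₀ hF₀, rfl⟩
    exact isEndNear_transform_of_rows C K m 𝓛 hΛ U hbd hne _
      (controlledTransform_eq_rows_onCentre C K m U hCregU hirrU hsnc hsncD hbd hKU hCsing)
      (hsncD.hasSNC_transform (blowup.isBlowup _)) x' hxU
  · -- OFF the centre: any presentation, shrunk off `V(C)`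
    obtain ⟨Λ, hΛ, U₀, hxU₀, hsnc₀, 𝒦, hbd, hne, hK₀⟩ := hEnd _ hxK
    set U : X.Opens := U₀ ⊓ ⟨(C.support : Set X)ᶜ, C.support.isClosed.isOpen_compl⟩ with hU
    have hxU : blowup.π C x' ∈ (U : Set X) := ⟨hxU₀, hxC⟩
    have hsnc := hasSNC_map_comap_ι_of_le (inf_le_left : U ≤ U₀) hsnc₀
    have hKU := comap_ι_eq_of_le (inf_le_left : U ≤ U₀) hK₀
    have hCU : C.comap U.ι = ⊤ := by
      rw [← Scheme.IdealSheafData.support_eq_bot_iff, Scheme.IdealSheafData.support_comap]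
      ext u
      simp only [Closeds.coe_preimage, Set.mem_preimage, Closeds.coe_bot, Set.mem_empty_iff_false, iff_false,
        Scheme.Opens.ι_apply]
      exact u.2.2
    exact isEndNear_transform_of_rows C K m 𝓛 hΛ U hbd hne _
      (controlledTransform_eq_rows_offCentre C K m U hCU hKU) (hasSNC_rows_offCentre C U hCU hsnc) x' hxU

end Main

end X3LemmaM

end Summit.ResolutionOfSingularities.ResolutionOfSingularities.Theorems

end
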